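import Mathlib
import Summits.NavierStokesRegularity.NavierStokesRegularity.Theorems.EulerZoomLiouvillePowerGaugeEulerLiouvilleHoopRunFreeDefs
import Summits.NavierStokesRegularity.NavierStokesRegularity.Theorems.EulerZoomLiouvillePowerGaugeEulerLiouvilleHoopIntervalHardy
import Summits.NavierStokesRegularity.NavierStokesRegularity.Theorems.EulerZoomLiouvillePowerGaugeEulerLiouvilleHoopRunTools
import Summits.NavierStokesRegularity.NavierStokesRegularity.Theorems.EulerZoomLiouvillePowerGaugeEulerLiouvilleHoopSliceChart
import Summits.NavierStokesRegularity.NavierStokesRegularity.Theorems.EulerZoomLiouvillePowerGaugeEulerLiouvilleHoopAxisChart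
import Summits.NavierStokesRegularity.NavierStokesRegularity.Theorems.EulerZoomLiouvillePowerGaugeEulerLiouvilleHoopCircleAvgCalculus
import HarnessLib

/-!
# Hoop core — t54-CAP part 2 (tools): ray-by-ray Hardy on the end discs, polar disc energy, the radial column of `|DV|_F²`

Sub-problem `NavierStokesRegularity`, crux `PowerGaugeEulerLiouville` (a crux CLASS of self-similar Euler/NS strata on the MODEL lattice —
not NS regularity, not E).  Seat ns-ezl-w3 g7, tag t54-CAP part 2 (nsreg-p2 g41 ROUND-51 «THE CAPS COME FOR FREE» §1, `r51/Sketch51.lean`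
3a26356e4f98d965).  Class-free, `C¹`.  The tools behind `…HoopCapHardy` (`endFluxHardy` / `axialRayHardy` / `radialRayHardy`):

* §1 joint-continuity bookkeeping on ABSTRACT `f : ℝ → ℝ → ℝ` given as `uncurry f` (the `…HoopAxisChart` warning: never restrict a
  concrete chart integrand by `.comp` — the unifier would delta-unfold `inner`/`axisPt`/`frobeniusNormSq`), Fubini on a rectangle
  (`intervalIntegral_swap_continuous`) and monotonicity of the iterated integral;
* §2 `discEnergy_eq_polar` — `discEnergy V σ T₀ = ∫₀^{2π}∫₀^{T₀} t·|DV(axisPt σ t θ)|_F² dt dθ` (`…HoopDisc` polar chart), domination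
  `integral_integral_le_discEnergy`, the radial column `⟪L R_θe₀, R_θe₀⟫² + ⟪L R_θe₀, e_z⟫² ≤ |L|_F²`, `hasDerivAt_sliceC_radius`,
  `continuous_rayData`;
* §3 `ray_hardy_integrated` / `ray_hardy_avg` — the one-dimensional Hardy inequality with end-point term (`HoopCore.intervalHardy_of_hasDerivAt`,
  `…HoopIntervalHardy`, LEAD g15) applied RAY BY RAY `t ↦ axisPt σ t θ` and integrated in `θ`:
  `∫θ∫t G² ≤ 2T₀∫θ G(T₀,θ)² + 2T₀∫θ∫t t·G'²`, and `≤ … + (T₀/π)·discEnergy` after averaging once `G'² ≤ |DV|_F²`.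

WHAT THIS IS NOT: not NS, not E — class-free calculus on discs; 19832 OPEN; NS regularity NOT proved.  [nsreg-p2 g41 ROUND-51 §1; folklore (Hardy)]
-/

noncomputable section

open MeasureTheory Set Metric Real Function WithLp intervalIntegral
open scoped InnerProductSpace RealInnerProductSpace Interval

set_option linter.dupNamespace false

namespace Summit.NavierStokesRegularity.NavierStokesRegularity.Theorems.PowerGaugeEulerLiouville.HoopCore

open Literature.Analysis Literature.Analysis.FluidPDE

variable {V : EuclideanSpace ℝ (Fin 3) → EuclideanSpace ℝ (Fin 3)}

/-! ## §1 Abstract joint-continuity bookkeeping (`uncurry` shapes) and Fubini on a rectangle -/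

/-- `uncurry f` continuous ⇒ `uncurry (fun θ t ↦ f t θ)` continuous. [folklore] -/
theorem continuous_uncurry_swap {f : ℝ → ℝ → ℝ} (hf : Continuous (uncurry f)) : Continuous (uncurry fun θ t : ℝ => f t θ) :=
  hf.comp (continuous_snd.prodMk continuous_fst)

/-- `uncurry f` continuous ⇒ `uncurry (fun t θ ↦ f t θ ^ 2)` continuous. [folklore] -/
theorem continuous_uncurry_sq {f : ℝ → ℝ → ℝ} (hf : Continuous (uncurry f)) : Continuous (uncurry fun t θ : ℝ => f t θ ^ 2) :=
  hf.pow 2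

/-- `uncurry f` continuous ⇒ `uncurry (fun t θ ↦ t * f t θ)` continuous. [folklore] -/
theorem continuous_uncurry_fst_mul {f : ℝ → ℝ → ℝ} (hf : Continuous (uncurry f)) :
    Continuous (uncurry fun t θ : ℝ => t * f t θ) :=
  continuous_fst.mul hf

/-- `uncurry f`, `uncurry g` continuous ⇒ `uncurry (fun t θ ↦ f t θ + g t θ)` continuous. [folklore] -/
theorem continuous_uncurry_add {f g : ℝ → ℝ → ℝ} (hf : Continuous (uncurry f)) (hg : Continuous (uncurry g)) :
    Continuous (uncurry fun t θ : ℝ => f t θ + g t θ) :=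
  hf.add hg

/-- `uncurry f` continuous ⇒ `uncurry (fun t θ ↦ k + f t θ)` continuous. [folklore] -/
theorem continuous_uncurry_const_add {f : ℝ → ℝ → ℝ} (hf : Continuous (uncurry f)) (k : ℝ) :
    Continuous (uncurry fun t θ : ℝ => k + f t θ) :=
  continuous_const.add hf

/-- A parametric interval integral of a jointly continuous integrand is continuous in the parameter (inner variable first in `f`):
`θ ↦ ∫_a^b f t θ dt` is continuous. [folklore] -/
theorem continuous_intervalIntegral_of_uncurry {f : ℝ → ℝ → ℝ} (hf : Continuous (uncurry f)) (a b : ℝ) :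
    Continuous fun θ : ℝ => ∫ t in a..b, f t θ :=
  intervalIntegral.continuous_parametric_intervalIntegral_of_continuous' (continuous_uncurry_swap hf) a b

/-- **Fubini on a rectangle for a continuous integrand** (interval-integral form, `a ≤ b`, `c ≤ d`). [folklore] -/
theorem intervalIntegral_swap_continuous {f : ℝ → ℝ → ℝ} (hf : Continuous (uncurry f)) {a b c d : ℝ} (hab : a ≤ b)
    (hcd : c ≤ d) :
    ∫ x in a..b, ∫ y in c..d, f x y = ∫ y in c..d, ∫ x in a..b, f x y := by
  rw [intervalIntegral.integral_of_le hab, intervalIntegral.integral_of_le hcd]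
  simp_rw [intervalIntegral.integral_of_le hcd, intervalIntegral.integral_of_le hab]
  have hint : Integrable (uncurry f) ((volume.restrict (Ioc a b)).prod (volume.restrict (Ioc c d))) := by
    rw [Measure.prod_restrict, ← Measure.volume_eq_prod]
    exact (hf.continuousOn.integrableOn_compact (isCompact_Icc.prod isCompact_Icc)).mono_set
      (prod_mono Ioc_subset_Icc_self Ioc_subset_Icc_self)
  exact integral_integral_swap hint

/-- **Monotonicity of the iterated integral over `[0, 2π] × [0, T₀]`** for continuous integrands compared on `[0,T₀] × ℝ`. [folklore] -/
theorem integral_integral_mono_continuous {H Φ : ℝ → ℝ → ℝ} (hH : Continuous (uncurry H)) (hΦ : Continuous (uncurry Φ))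
    {T₀ : ℝ} (hT₀ : 0 ≤ T₀) (hle : ∀ t ∈ Icc 0 T₀, ∀ θ, H t θ ≤ Φ t θ) :
    ∫ θ in (0 : ℝ)..2 * π, ∫ t in (0 : ℝ)..T₀, H t θ ≤ ∫ θ in (0 : ℝ)..2 * π, ∫ t in (0 : ℝ)..T₀, Φ t θ := by
  refine intervalIntegral.integral_mono_on (by positivity)
    ((continuous_intervalIntegral_of_uncurry hH 0 T₀).intervalIntegrable _ _)
    ((continuous_intervalIntegral_of_uncurry hΦ 0 T₀).intervalIntegrable _ _) fun θ _ => ?_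
  exact intervalIntegral.integral_mono_on hT₀ ((continuous_of_uncurry_right hH θ).intervalIntegrable _ _)
    ((continuous_of_uncurry_right hΦ θ).intervalIntegrable _ _) fun t ht => hle t ht θ

/-! ## §2 The disc energy in polar coordinates; the radial column of `|DV|_F²` -/

/-- `liftAt σ` is continuous. [folklore] -/
theorem continuous_liftAt (σ : ℝ) : Continuous (liftAt σ) := by
  unfold liftAt
  fun_prop

/-- `(t, θ) ↦ |DV(axisPt σ t θ)|_F²` is jointly continuous for `V ∈ C¹`. [folklore] -/
theorem continuous_frobeniusNormSq_fderiv_axisPt (hV : ContDiff ℝ 1 V) (σ : ℝ) :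
    Continuous (uncurry fun t θ : ℝ => frobeniusNormSq (fderiv ℝ V (axisPt σ t θ))) :=
  (continuous_frobeniusNormSq_fderiv hV).comp (continuous_axisPt_radius_angle σ)

/-- **The disc energy in polar coordinates** (`V ∈ C¹`, `T₀ ≥ 0`), angle outside:
`discEnergy V σ T₀ = ∫₀^{2π} ∫₀^{T₀} t·|DV(axisPt σ t θ)|_F² dt dθ`. [folklore] -/
theorem discEnergy_eq_polar (hV : ContDiff ℝ 1 V) (σ : ℝ) {T₀ : ℝ} (hT₀ : 0 ≤ T₀) :
    discEnergy V σ T₀ = ∫ θ in (0 : ℝ)..2 * π, ∫ t in (0 : ℝ)..T₀, t * frobeniusNormSq (fderiv ℝ V (axisPt σ t θ)) := by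
  have hG : IntegrableOn (fun z : EuclideanSpace ℝ (Fin 2) => frobeniusNormSq (fderiv ℝ V (liftAt σ z)))
      (closedBall (0 : EuclideanSpace ℝ (Fin 2)) T₀) :=
    ((continuous_frobeniusNormSq_fderiv hV).comp (continuous_liftAt σ)).continuousOn.integrableOn_compact
      (isCompact_closedBall _ _)
  have hsw := intervalIntegral_swap_continuous
    (continuous_uncurry_swap (continuous_uncurry_fst_mul (continuous_frobeniusNormSq_fderiv_axisPt hV σ)))
    (by positivity : (0 : ℝ) ≤ 2 * π) hT₀
  unfold discEnergy
  rw [setIntegral_closedBall_eq _ hG hT₀, hsw]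
  refine intervalIntegral.integral_congr fun t _ => ?_
  simp only [liftAt_eq_axisPt, smul_eq_mul]
  rw [intervalIntegral.integral_const_mul]

/-- **Domination by the disc energy**: a continuous `H` with `H(t,θ) ≤ t·|DV(axisPt σ t θ)|_F²` on `[0,T₀] × ℝ` has
`∫₀^{2π}∫₀^{T₀} H dt dθ ≤ discEnergy V σ T₀` (`V ∈ C¹`, `T₀ ≥ 0`). [folklore] -/
theorem integral_integral_le_discEnergy (hV : ContDiff ℝ 1 V) (σ : ℝ) {T₀ : ℝ} (hT₀ : 0 ≤ T₀) {H : ℝ → ℝ → ℝ}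
    (hH : Continuous (uncurry H)) (hle : ∀ t ∈ Icc 0 T₀, ∀ θ, H t θ ≤ t * frobeniusNormSq (fderiv ℝ V (axisPt σ t θ))) :
    ∫ θ in (0 : ℝ)..2 * π, ∫ t in (0 : ℝ)..T₀, H t θ ≤ discEnergy V σ T₀ := by
  rw [discEnergy_eq_polar hV σ hT₀]
  exact integral_integral_mono_continuous hH
    (continuous_uncurry_fst_mul (continuous_frobeniusNormSq_fderiv_axisPt hV σ)) hT₀ hle

/-- **The radial column of the Frobenius norm**: for every linear `L` and every `θ`,
`⟪L R_θe₀, R_θe₀⟫² + ⟪L R_θe₀, e_z⟫² ≤ |L|_F²`. [folklore] -/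
theorem radialEntries_sq_le_frobeniusNormSq (L : EuclideanSpace ℝ (Fin 3) →L[ℝ] EuclideanSpace ℝ (Fin 3)) (θ : ℝ) :
    ⟪L (rotZ θ (EuclideanSpace.single (0 : Fin 3) (1 : ℝ))), rotZ θ (EuclideanSpace.single (0 : Fin 3) (1 : ℝ))⟫ ^ 2 +
        ⟪L (rotZ θ (EuclideanSpace.single (0 : Fin 3) (1 : ℝ))), eZ⟫ ^ 2 ≤ frobeniusNormSq L := by
  set f₀ := rotZ θ (EuclideanSpace.single (0 : Fin 3) (1 : ℝ)) with hf₀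
  set f₁ := rotZ θ (EuclideanSpace.single (1 : Fin 3) (1 : ℝ)) with hf₁
  have hF : frobeniusNormSq L = ‖L f₀‖ ^ 2 + ‖L f₁‖ ^ 2 + ‖L eZ‖ ^ 2 := by
    rw [frobeniusNormSq_eq_sum ((EuclideanSpace.basisFun (Fin 3) ℝ).map (rotZLIE θ)) L, Fin.sum_univ_three]
    simp only [OrthonormalBasis.map_apply, EuclideanSpace.basisFun_apply, rotZLIE_apply]
    rw [← eZ_eq_rotZ θ]
  have h1 : ‖L f₀‖ ^ 2 = ⟪L f₀, f₀⟫ ^ 2 + ⟪L f₀, f₁⟫ ^ 2 + ⟪L f₀, eZ⟫ ^ 2 := by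
    rw [← ((EuclideanSpace.basisFun (Fin 3) ℝ).map (rotZLIE θ)).sum_sq_inner_right (L f₀), Fin.sum_univ_three]
    simp only [OrthonormalBasis.map_apply, EuclideanSpace.basisFun_apply, rotZLIE_apply]
    rw [← eZ_eq_rotZ θ, real_inner_comm (L f₀), real_inner_comm (L f₀), real_inner_comm (L f₀)]
  rw [hF, h1]
  nlinarith [sq_nonneg ‖L f₁‖, sq_nonneg ‖L eZ‖, sq_nonneg ⟪L f₀, f₁⟫]

/-- **Radial law of `c = V_z∘axisPt`**: `∂_t V_z(axisPt s t θ) = ⟪DV R_θe₀, e_z⟫` (every `t`). [folklore] -/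
theorem hasDerivAt_sliceC_radius (hV : Differentiable ℝ V) (s t θ : ℝ) :
    HasDerivAt (fun t : ℝ => axialVelocity V (axisPt s t θ))
      ⟪fderiv ℝ V (axisPt s t θ) (rotZ θ (EuclideanSpace.single (0 : Fin 3) (1 : ℝ))), eZ⟫ t := by
  have h1 : HasDerivAt (fun t : ℝ => V (axisPt s t θ))
      (fderiv ℝ V (axisPt s t θ) (rotZ θ (EuclideanSpace.single (0 : Fin 3) (1 : ℝ)))) t :=
    (hV _).hasFDerivAt.comp_hasDerivAt t (hasDerivAt_axisPt_radius' s t θ)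
  have h := h1.inner ℝ (hasDerivAt_const t eZ)
  simp only [inner_zero_right, zero_add] at h
  simp_rw [axialVelocity_eq_inner_eZ]
  exact h

/-- Joint continuity of the two ray components `a = ⟪V∘axisPt, R_θe₀⟫`, `c = V_z∘axisPt` at height `σ` and of their radial derivatives
(`V ∈ C¹`; `uncurry` shapes). [folklore] -/
theorem continuous_rayData (hV : ContDiff ℝ 1 V) (σ : ℝ) :
    Continuous (uncurry fun t θ : ℝ => ⟪V (axisPt σ t θ), rotZ θ (EuclideanSpace.single (0 : Fin 3) (1 : ℝ))⟫) ∧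
    Continuous (uncurry fun t θ : ℝ =>
      ⟪fderiv ℝ V (axisPt σ t θ) (rotZ θ (EuclideanSpace.single (0 : Fin 3) (1 : ℝ))),
        rotZ θ (EuclideanSpace.single (0 : Fin 3) (1 : ℝ))⟫) ∧
    Continuous (uncurry fun t θ : ℝ => axialVelocity V (axisPt σ t θ)) ∧
    Continuous (uncurry fun t θ : ℝ =>
      ⟪fderiv ℝ V (axisPt σ t θ) (rotZ θ (EuclideanSpace.single (0 : Fin 3) (1 : ℝ))), eZ⟫) := by
  have hVc : Continuous V := hV.continuous
  exact ⟨continuous_uncurry_slice (continuous_sliceA hVc) σ,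
    continuous_uncurry_slice (continuous_sliceEntry hV continuous_rotZ_single_zero continuous_rotZ_single_zero) σ,
    continuous_uncurry_slice (continuous_sliceC hVc) σ,
    continuous_uncurry_slice (continuous_sliceEntry hV (w := fun _ => eZ) continuous_rotZ_single_zero continuous_const) σ⟩

/-! ## §3 The ray-by-ray Hardy inequality, integrated over the angle -/

/-- **Ray-by-ray Hardy, integrated in `θ`**: if `t ↦ G t θ` has the (jointly continuous) derivative `G' t θ` for every `θ`, then
`∫₀^{2π}∫₀^{T₀} G² dt dθ ≤ 2T₀·∫₀^{2π} G(T₀,θ)² dθ + 2T₀·∫₀^{2π}∫₀^{T₀} t·G'(t,θ)² dt dθ` (`T₀ > 0`).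
[folklore (Hardy), via `intervalHardy_of_hasDerivAt`] -/
theorem ray_hardy_integrated {G G' : ℝ → ℝ → ℝ} (hG : Continuous (uncurry G)) (hG' : Continuous (uncurry G'))
    (hd : ∀ θ t, HasDerivAt (fun t => G t θ) (G' t θ) t) {T₀ : ℝ} (hT₀ : 0 < T₀) :
    ∫ θ in (0 : ℝ)..2 * π, ∫ t in (0 : ℝ)..T₀, G t θ ^ 2
      ≤ 2 * T₀ * (∫ θ in (0 : ℝ)..2 * π, G T₀ θ ^ 2)
        + 2 * T₀ * ∫ θ in (0 : ℝ)..2 * π, ∫ t in (0 : ℝ)..T₀, t * G' t θ ^ 2 := by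
  -- the ray inequality
  have hray : ∀ θ, ∫ t in (0 : ℝ)..T₀, G t θ ^ 2 ≤ 2 * T₀ * G T₀ θ ^ 2 + 2 * T₀ * ∫ t in (0 : ℝ)..T₀, t * G' t θ ^ 2 :=
    fun θ => intervalHardy_of_hasDerivAt hT₀ (hd θ) (continuous_of_uncurry_right hG' θ)
  -- continuity in `θ` of the three `θ`-integrands
  have hθG : Continuous fun θ => G T₀ θ ^ 2 := (continuous_of_uncurry_left hG T₀).fun_pow 2
  have hI1 : Continuous fun θ => ∫ t in (0 : ℝ)..T₀, G t θ ^ 2 :=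
    continuous_intervalIntegral_of_uncurry (continuous_uncurry_sq hG) 0 T₀
  have hI2 : Continuous fun θ => ∫ t in (0 : ℝ)..T₀, t * G' t θ ^ 2 :=
    continuous_intervalIntegral_of_uncurry (continuous_uncurry_fst_mul (continuous_uncurry_sq hG')) 0 T₀
  have i1 : IntervalIntegrable (fun θ => 2 * T₀ * G T₀ θ ^ 2) volume 0 (2 * π) :=
    (continuous_const.fun_mul hθG).intervalIntegrable _ _
  have i2 : IntervalIntegrable (fun θ => 2 * T₀ * ∫ t in (0 : ℝ)..T₀, t * G' t θ ^ 2) volume 0 (2 * π) :=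
    (continuous_const.fun_mul hI2).intervalIntegrable _ _
  calc ∫ θ in (0 : ℝ)..2 * π, ∫ t in (0 : ℝ)..T₀, G t θ ^ 2
      ≤ ∫ θ in (0 : ℝ)..2 * π, (2 * T₀ * G T₀ θ ^ 2 + 2 * T₀ * ∫ t in (0 : ℝ)..T₀, t * G' t θ ^ 2) :=
        intervalIntegral.integral_mono_on (by positivity) (hI1.intervalIntegrable _ _) (i1.add i2) fun θ _ => hray θ
    _ = 2 * T₀ * (∫ θ in (0 : ℝ)..2 * π, G T₀ θ ^ 2)
          + 2 * T₀ * ∫ θ in (0 : ℝ)..2 * π, ∫ t in (0 : ℝ)..T₀, t * G' t θ ^ 2 := by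
        rw [intervalIntegral.integral_add i1 i2, intervalIntegral.integral_const_mul, intervalIntegral.integral_const_mul]

/-- The averaged form: `(2π)⁻¹·∫θ∫t G² ≤ 2T₀·((2π)⁻¹∫θ G(T₀,θ)²) + (T₀/π)·discEnergy` once `t·G'² ≤ t·|DV|_F²` pointwise. [folklore] -/
theorem ray_hardy_avg (hV : ContDiff ℝ 1 V) (σ : ℝ) {G G' : ℝ → ℝ → ℝ} (hG : Continuous (uncurry G))
    (hG' : Continuous (uncurry G')) (hd : ∀ θ t, HasDerivAt (fun t => G t θ) (G' t θ) t) {T₀ : ℝ} (hT₀ : 0 < T₀)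
    (hle : ∀ t θ, G' t θ ^ 2 ≤ frobeniusNormSq (fderiv ℝ V (axisPt σ t θ))) :
    1 / (2 * Real.pi) * ∫ θ in (0 : ℝ)..2 * π, ∫ t in (0 : ℝ)..T₀, G t θ ^ 2
      ≤ 2 * T₀ * (1 / (2 * Real.pi) * ∫ θ in (0 : ℝ)..2 * π, G T₀ θ ^ 2) + T₀ / Real.pi * discEnergy V σ T₀ := by
  have hH := ray_hardy_integrated hG hG' hd hT₀
  have hdom : ∫ θ in (0 : ℝ)..2 * π, ∫ t in (0 : ℝ)..T₀, t * G' t θ ^ 2 ≤ discEnergy V σ T₀ :=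
    integral_integral_le_discEnergy hV σ hT₀.le (continuous_uncurry_fst_mul (continuous_uncurry_sq hG'))
      fun t ht θ => mul_le_mul_of_nonneg_left (hle t θ) ht.1
  have hπ : 0 < Real.pi := Real.pi_pos
  have h1 := mul_le_mul_of_nonneg_left hH (by positivity : (0 : ℝ) ≤ 1 / (2 * Real.pi))
  have h2 := mul_le_mul_of_nonneg_left hdom (by positivity : (0 : ℝ) ≤ T₀ / Real.pi)
  have e : 1 / (2 * Real.pi) * (2 * T₀ * (∫ θ in (0 : ℝ)..2 * π, G T₀ θ ^ 2)
        + 2 * T₀ * ∫ θ in (0 : ℝ)..2 * π, ∫ t in (0 : ℝ)..T₀, t * G' t θ ^ 2)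
      = 2 * T₀ * (1 / (2 * Real.pi) * ∫ θ in (0 : ℝ)..2 * π, G T₀ θ ^ 2)
        + T₀ / Real.pi * ∫ θ in (0 : ℝ)..2 * π, ∫ t in (0 : ℝ)..T₀, t * G' t θ ^ 2 := by
    field_simp
  linarith [h1, h2, e]

end Summit.NavierStokesRegularity.NavierStokesRegularity.Theorems.PowerGaugeEulerLiouville.HoopCore

end
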